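import Literature.NumberTheory.LFunctions.SuzukiWeilHilbertSpaceDefs
import Literature.NumberTheory.LFunctions.ZetaScrewHermitianForms
import HarnessLib

/-!
# Suzuki's screw line `𝔖_t` of the Riemann zeta-function (Suzuki, Canad. J. Math. 2025, §§1–4, 7)

LINE 1 — LABEL: RH-FREE corpus typing. The objects (`𝔓_t`, `𝔖_t`, `P_t`, `F_γ`, `P̂_φ`, `‖·‖₀`, `𝓚₀`,
`H²`, `𝒦(Θ)`) and Props. 1.2, 1.3, 3.1, Lemma 3.2, Thm. 7.1 are RH-FREE; Thm. 4.2 and Prop. 4.1 are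
RH-CONSEQUENCES (printed "Assume the RH", explicit `RiemannHypothesis →` binder); Thm. 1.4,
Cor. 4.3, Thm. 4.4 (and Thm. 4.5, proved from 1.4 in the Proofs file) are RH-EQUIVALENT criteria (both directions
are printed theorems). Typing them fixes WHICH identity (`‖P̂_{Dψ}‖² = π⟨ψ,ψ⟩_W` on `C_c^∞(ℝ)`)
would prove RH through this door; it does not move RH. WHAT THIS IS NOT: not a route, not a proof
plan for RH, no positivity or Hermite–Biehler property of `E_ξ` is asserted (Conrey–Li guard);
nothing here bears on the truth of RH.

SOURCE OF RECORD. M. Suzuki, *On the Hilbert space derived from the Weil distribution*, Canad. J.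
Math. (2025), doi:10.4153/S0008414X25101739 = arXiv:2301.00421v3 (`Suzuki2025WeilHilbertSpace`;
locators "CJM (n.m), TeX l.nnn" refer to the author's v3 TeX held by the cell). This version ABSORBS
the preprint M. Suzuki, *The screw line of the Riemann zeta-function and its applications*,
arXiv:2209.04658v3 (`Suzuki2022`, no journal version); concordance (CJM ← preprint):
Prop 1.2 ← Prop 1.1, Prop 1.3 ← Prop 1.2, Thm 1.4 ← Cor 1.2, Prop 3.1 ← Prop 2.1, Prop 4.1 ← Prop 3.1
(= Suzuki, J. Number Theory 252 (2023), Prop 3.2), Thm 4.2 ← Thm 1.1, Cor 4.3 ← Cor 1.1,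
Thm 4.4 ← Thm 1.2, Thm 7.1 ← Thm 4.1. CONVENTION CHANGE between the two texts (checked term by
term): `𝔓_t^{CJM}(z) = 𝔓_t^{2209}(−z)` (the preprint's bracket
`[Z′/Z(½−iz) − ½log π + ½(Γ′/Γ)(¼+iz/2)]`, `Z(s) = π^{−s/2}Γ(s/2)ζ(s)`, equals `−ζ′/ζ(½+iz)` by
`Z′/Z(s) = −Z′/Z(1−s)`), `𝔖_t^{CJM} = i(1+Θ♯)/2 · 𝔓_t` versus `i(1+Θ)/(2√π) · 𝔓_t`, hence the
factors `π`, `1/2π` in CJM (1.9), (4.6) versus `1`, `2` in the preprint's (1.11), (1.7). We type the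
CJM text.

DICTIONARY (paper ↦ tree; nothing is re-declared):
* `ξ` = `riemannXi`; `E_ξ(z) = ξ(½−iz)+ξ′(½−iz)` (1.3) = `lagariasE`; `Θ_ξ = E_ξ♯/E_ξ` (1.4) =
  `lagariasTheta`; `F♯(z) = conj F(z̄)` = `Literature.Analysis.DeBrangesSpaces.sharp`;
  `Γ` (zeros of `ξ(½−iz)`, multiplicity `m_γ`) is indexed by the non-trivial zeros `ρ` of `ζ`
  through `γ = i(ρ−½)` = `suzukiZeroParam ρ`, `m_γ = riemannZetaZeroOrder ρ`
  (all from `SuzukiWeilHilbertSpaceDefs`).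
* `g_ξ(t)` (4.3) `= −4(e^{t/2}+e^{−t/2}−2) + Σ_{n≤e^t} Λ(n)n^{−1/2}(t−log n) − (t/2)[(Γ′/Γ)(¼) − log π]
  − ¼(Φ(1,2,¼) − e^{−t/2}Φ(e^{−2t},2,¼))` is token for token `−Ψ(t)` of Suzuki, JLMS 2023, (1.1) =
  `−zetaScrew t` (`ZetaScrew.lean`, which spells `(Γ′/Γ)(¼) − log π = −(γ₀ + π/2 + 3 log 2 + log π)`
  by Gauss and extends evenly); the Kreĭn kernel `G_g(t,u) = g(t−u) − g(t) − g(−u) + g(0)` (2.1)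
  is `zetaScrewKernel t u` (`zetaScrewKernel_eq_krein`), `G_g(t,t) = −2g(t) = 2Ψ(t)`
  (`zetaScrewKernel_self`); the hermitian form (2.2) `⟨φ₁,φ₂⟩_{G_g} = ∫∫ G_g(t,u)φ₁(u)conj φ₂(t) du dt`
  on `C_c^∞(ℝ)` is `zetaScrewForm univ φ₁ φ₂` (`ZetaScrewHermitianForms.lean`, window `S = univ`), and
  (4.10) `⟨Dψ₁,Dψ₂⟩_{G_g} = ⟨ψ₁,ψ₂⟩_W` is Suzuki JLMS 2023 Prop 3.1 = `Suzuki2023_prop31` there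
  (windowed form; the factor `i` of (1.8) cancels in the sesquilinear form).
* `C_c^∞(ℝ)` = `IsWeilTest` (`ContDiff ℝ ∞ ∧ HasCompactSupport`, `WeilExplicit.lean`). The Weil
  hermitian form (1.2) `⟨ψ₁,ψ₂⟩_W = W(ψ₁ ∗ ψ̃₂)`, `ψ̃(x) = conj ψ(−x)`, `W(φ) = Σ_γ m_γ φ̂(−γ)`,
  `φ̂(z) = ∫φ(x)e^{izx}dx` (1.1): since `−iγ_ρ = ρ − ½`, `φ̂(−γ_ρ) = weilMellin φ ρ`, so `W` is the
  tree's zero side `HasWeilZeroSide` and, on `C_c^∞(ℝ)`, equals the arithmetic side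
  `weilFunctional` by the explicit formula (`explicit_formula_holds`); `ψ̃ = weilReflect ψ`,
  `∗ = weilConv`. Accordingly `⟨ψ,ψ⟩_W` on `C_c^∞(ℝ)` is typed as COLUMN 2's `weilQuadratic ψ`
  (`= weilFunctional (ψ ⋆ ψ̃)`); the criteria below are Weil's criterion re-indexed by the author's
  own proofs (CJM §4.3) — no new positivity object is introduced.
* `H² = 𝖥L²(0,∞)` ⊂ `L²(ℝ)` via boundary values (§2.3): with Mathlib's `𝓕` on `Lp ℂ 2`
  (kernel `e^{−2πixξ}`) one has `(𝖥f)(u) = ∫f(x)e^{iux}dx = 𝓕⁻(ξ ↦ 2πf(2πξ))(u)`, and the dilation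
  preserves `L²(0,∞)`, so `H² = {F ∈ L²(ℝ) : 𝓕F = 0 a.e. on (−∞,0)}` (`hardyL2`); `𝒦(Θ) = H² ⊖ ΘH²`
  (§2.4) is `modelSpaceL2 Θ`. These are membership predicates only (no Hardy-space theory).

JUNK-VALUE BOOKKEEPING. (1.6) is a sum of meromorphic terms whose poles at `z = 0`, `z = i/2`,
`z = −i(2n+½)` cancel; a pointwise Lean transcription carries Lean's `x/0 = 0` junk exactly there
(and `Θ_ξ = 0/0` at the real zeros of `E_ξ`, a null set). Hence: `L²` statements are unaffected;
Prop. 3.1 is stated off that discrete set and off `Γ`; the special values (7.1), (4.1), (4.2) are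
typed as the LIMITS the printed proofs compute ("taking the limit `z → 0` in (1.6)", CJM §7;
"`Θ′(γ)/2 = lim_{z→γ}(1+Θ(z))/(2(z−γ))`", JNT 2023 proof of Prop 3.2); (7.2) is a limit along
`y → +∞` avoiding the cancelling poles `y = 2n+½`. The bracket
`[Φ(e^{−2t},1,½(½−iz)) − Φ(e^{−2t},1,¼)]` of (1.6) is typed as ONE series (termwise difference,
`screwLerchBracket`): for `t ≠ 0` both Lerch series converge and nothing changes; at `t = 0` this is
the limit value `(Γ′/Γ)(¼) − (Γ′/Γ)(½(½−iz))` by (2.8), which is how the paper evaluates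
`𝔖_0 ≡ 0` (proof of Thm 4.2). `𝔓_t`, `P_t`, `𝔖_t` are extended to negative `t` by `t ↦ |t|`
("For negative `t`, we set `𝔖_t := 𝔖_{−t}`", after (1.6); "`P_t := P_{−t}`", after (3.2)).
"`𝔅_t`" in the printed (7.2) is `𝔓_t` (the proof computes `y𝔓_t(−iy)`). Floating-point check of
the transcription of (1.6) (this file's term evaluated numerically, `ζ′/ζ(½) = −3.92265/−1.46035`):
`𝔓_t(10⁻⁵) = 0.047366, 0.044007, 0.048435` for `t = 0.3, 1, 2.5`, equal to `Ψ(t) = zetaScrew t` to six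
places — this is (7.1) — and `𝔓_0(x) = 0` (`x = 0.7, 3, −2.2`) to truncation accuracy (`𝔖_0 ≡ 0`).

DELIBERATELY NOT HERE. Thm 1.1, §5 (`𝖪`, `V(t)`, Lemma 5.1–Prop 5.8), §6: `SuzukiWeilHilbertSpace*.lean`.
Cor 1.5 (`V°(0) := {𝖥⁻¹P̂_{Dψ}}`; `⟨ψ,ψ⟩_W` for `ψ ∈ V°(0) ⊂ L²(ℝ)` is given meaning in print only
through `ψ̂(γ) = ψ̂₀(γ)` ((3.8), (4.2), argued under RH) — it needs the cell's `L²` Weil-form reading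
(`HasHatValue`), not typed here). Cor 4.6 ("RH holds if (4.11) holds for all Bombieri–Lagarias
`g_n`"): as printed it applies `‖·‖₀`, defined on `C_c^∞(ℝ)` by (3.9)/Lemma 3.2, to `g_n ∉ C_c^∞(ℝ)`
(jump at `0`, support `[0,∞)`); its input "RH holds if `⟨g_n,g_n⟩_W ≥ 0 ∀n`" [Bombieri–Lagarias
1999 §4] is the tree's Li criterion (`li_criterion_holds`). Thm 1.4's clause "if (1.9) holds for
countably many [suitably chosen] `ψ`'s, then the RH follows" is formally implied by the typed
equivalence. Thm 4.5 ("(1.9) ÷ π") is proved from `Suzuki2025_thm14` in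
`SuzukiScrewLineProofs.lean`, where the discharges live; this module is statements and definitions only.
-/

noncomputable section

open MeasureTheory Complex Filter Set
open Literature.Analysis.DeBrangesSpaces (sharp)
open scoped ComplexConjugate FourierTransform Topology ENNReal InnerProductSpace

namespace Literature.NumberTheory.LFunctions

/-! ## §2.1 Screw lines (Kreĭn–Langer) -/

/-- RH-FREE (a definition). A **screw line for the kernel `G`** in a complex Hilbert space `H`
(Kreĭn–Langer, as recalled in CJM §2.1, TeX l.527–541): a continuous map `x : ℝ → H` such that
`⟨x(t+v) − x(v), x(u+v) − x(v)⟩_H` is independent of `v` and equals `G(t,u)` at `v = 0` —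
equivalently (as typed) equals `G(t,u)` for every `v`. The printed inner product is linear in the
FIRST slot; Mathlib's `⟪·,·⟫_ℂ` is linear in the second, whence the order of the arguments below
(immaterial for the real symmetric kernel `G_g`). For a screw function `g` with `g(0) = 0` one takes
`G = G_g` of (2.1), and then `‖x(t) − x(0)‖² = −2g(t)`.
[cite: Suzuki2025WeilHilbertSpace, §2.1 (TeX l.527–541); KreinLanger2013 §§5, 12] -/
def IsScrewLineFor {H : Type*} [NormedAddCommGroup H] [InnerProductSpace ℂ H]
    (x : ℝ → H) (G : ℝ → ℝ → ℂ) : Prop :=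
  Continuous x ∧ ∀ t u v : ℝ, ⟪x (u + v) - x v, x (t + v) - x v⟫_ℂ = G t u

/-! ## §1 The functions `𝔓_t`, `𝔖_t`, `P̂_φ` -/

/-- RH-FREE object. The Hurwitz–Lerch bracket `[Φ(e^{−2|t|},1,½(½−iz)) − Φ(e^{−2|t|},1,¼)]` of
(1.6), `Φ(r,1,a) = Σ_{n≥0} rⁿ/(n+a)`, typed as the single series
`Σ_{n≥0} e^{−2|t|n} (1/(n+½(½−iz)) − 1/(n+¼))` (termwise difference: for `t ≠ 0` both Lerch series
converge absolutely, so this IS the printed difference; at `t = 0` it is the limit value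
`(Γ′/Γ)(¼) − (Γ′/Γ)(½(½−iz))` used in the proof of Thm 4.2, TeX l.1232–1240). Lean junk `1/0 = 0`
in the `n`-th term exactly at the cancelling poles `z = −i(2n+½)`.
[cite: Suzuki2025WeilHilbertSpace, eq. (1.6) (TeX l.325–345)] -/
def screwLerchBracket (t : ℝ) (z : ℂ) : ℂ :=
  ∑' n : ℕ, (Real.exp (-(2 * |t| * n)) : ℂ) *
    (1 / ((n : ℂ) + (1 / 2 - I * z) / 2) - 1 / ((n : ℂ) + 1 / 4))

/-- RH-FREE object. **`𝔓_t(z)`** of CJM (1.6), verbatim (with `t ↦ |t|`, see the module docstring):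
`𝔓_t(z) = 4(e^{t/2}−1)/(1+2iz) + 4(e^{−t/2}−1)/(1−2iz) + (e^{−izt}−1)/(iz) · ζ′/ζ(½−iz)
  + Σ_{n≤e^t} Λ(n)n^{−1/2} (e^{−iz(t−log n)}−1)/(iz) − (1/2iz)[(Γ′/Γ)(¼−iz/2) − (Γ′/Γ)(¼)]
  − (1/2iz) e^{−t/2} [Φ(e^{−2t},1,½(½−iz)) − Φ(e^{−2t},1,¼)]`,
`Λ` = `ArithmeticFunction.vonMangoldt`, `Γ′/Γ` = `Complex.digamma`, `ζ′/ζ = deriv ζ/ζ`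
(`riemannZeta`). A meromorphic function of `z` whose only poles are simple poles at `γ ∈ Γ`
(Prop 3.1); the pointwise term carries junk at `z = 0`, `z = i/2`, `z = −i(2n+½)` (cancelling poles
of the individual terms). [cite: Suzuki2025WeilHilbertSpace, eq. (1.6) (TeX l.325–345)] -/
def screwP (t : ℝ) (z : ℂ) : ℂ :=
  4 * ((Real.exp (|t| / 2) - 1 : ℝ) : ℂ) / (1 + 2 * I * z) +
    4 * ((Real.exp (-(|t| / 2)) - 1 : ℝ) : ℂ) / (1 - 2 * I * z) +
    (cexp (-(I * z * (|t| : ℝ))) - 1) / (I * z) *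
      (deriv riemannZeta (1 / 2 - I * z) / riemannZeta (1 / 2 - I * z)) +
    (∑ n ∈ Finset.Icc 1 ⌊Real.exp |t|⌋₊,
      ((ArithmeticFunction.vonMangoldt n / Real.sqrt n : ℝ) : ℂ) *
        ((cexp (-(I * z * ((|t| - Real.log n : ℝ) : ℂ))) - 1) / (I * z))) -
    1 / (2 * I * z) * (Complex.digamma (1 / 4 - I * z / 2) - Complex.digamma (1 / 4)) -
    1 / (2 * I * z) * ((Real.exp (-(|t| / 2)) : ℝ) : ℂ) * screwLerchBracket t z

/-- RH-FREE object. **The screw line `𝔖_t(z) := i(1 + Θ_ξ♯(z))/2 · 𝔓_t(z)`** of CJM (1.5)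
(`Θ_ξ♯ = E_ξ/E_ξ♯` off the zeros; `sharp lagariasTheta`), for real `t` (even in `t`) and complex
`z`. On the real line the simple poles of `𝔓_t` at real `γ ∈ Γ` are cancelled by the zeros of
`1 + Θ_ξ♯` (CJM §3.2); pointwise junk only on the null set discussed in the module docstring.
[cite: Suzuki2025WeilHilbertSpace, eq. (1.5) (TeX l.320–323)] -/
def screwLine (t : ℝ) (z : ℂ) : ℂ :=
  I * (1 + sharp lagariasTheta z) / 2 * screwP t z

/-- RH-FREE object. The differential operator `(Dψ)(t) := iψ′(t)` of CJM (1.8) (Lean `deriv`; for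
`ψ ∈ C_c^∞(ℝ)` this is the classical derivative). [cite: Suzuki2025WeilHilbertSpace, eq. (1.8) (TeX l.412–416)] -/
def suzukiD (ψ : ℝ → ℂ) : ℝ → ℂ :=
  fun t ↦ I * deriv ψ t

/-- RH-FREE object. **`P̂_φ(z) := ∫ 𝔖_t♯(z) φ(t) dt`** `(= ∫ conj(𝔖_t(z̄)) φ(t) dt)` of CJM (1.7), for
`φ ∈ C_c^∞(ℝ)` (Bochner integral in `t` over `ℝ`; `♯` acts in the variable `z`).
[cite: Suzuki2025WeilHilbertSpace, eq. (1.7) (TeX l.395–405)] -/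
def screwPhat (φ : ℝ → ℂ) (z : ℂ) : ℂ :=
  ∫ t : ℝ, sharp (screwLine t) z * φ t

/-! ## §3.1 The zero expansion `P_t` and Prop 3.1 -/

/-- RH-FREE object. **`P_t(z) := Σ_{γ∈Γ} m_γ (e^{−iγt} − 1)/γ · 1/(z − γ)`** of CJM (3.2) (`t ≥ 0`;
`P_t := P_{−t}` for `t < 0`, here via `|t|`), an unconditional sum over the non-trivial zeros `ρ`
(`γ = suzukiZeroParam ρ`, `m_γ = riemannZetaZeroOrder ρ`). The series converges absolutely and
locally uniformly on `ℂ ∖ Γ` since `Σ m_γ|γ|^{−1−δ} < ∞` (TeX l.776–781), so off `Γ` the `tsum` is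
the printed value. [cite: Suzuki2025WeilHilbertSpace, eq. (3.2) (TeX l.768–781)] -/
def screwZeroExpansion (t : ℝ) (z : ℂ) : ℂ :=
  ∑' ρ : ZetaZeros.riemannZetaNontrivialZeros,
    (riemannZetaZeroOrder (ρ : ℂ) : ℂ) *
      ((cexp (-(I * suzukiZeroParam ρ * (|t| : ℝ))) - 1) / suzukiZeroParam ρ) *
      (1 / (z - suzukiZeroParam ρ))

/-- RH-FREE · **CJM Prop 3.1** (= arXiv:2209.04658 Prop 2.1): the meromorphic functions `𝔓_t` (1.6)
and `P_t` (3.2) coincide. Typed pointwise at every `z` where all printed terms are finite: off `Γ`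
and off the cancelling poles `0`, `i/2`, `−i(2n+½)` of the individual terms of (1.6) (module
docstring). Printed proof: Weil's explicit formula (3.3) [Bombieri 2000, p. 186] applied to the test
function `φ_{z,t}` (TeX l.791–980), then analytic continuation.
[cite: Suzuki2025WeilHilbertSpace, Prop. 3.1 (TeX l.789–793)] -/
def Suzuki2025_prop31 : Prop :=
  ∀ t : ℝ, ∀ z : ℂ, z ≠ 0 → z ≠ I / 2 → (∀ n : ℕ, z ≠ -(I * (2 * n + 1 / 2))) →
    (∀ ρ ∈ ZetaZeros.riemannZetaNontrivialZeros, z ≠ suzukiZeroParam ρ) →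
      screwP t z = screwZeroExpansion t z

/-! ## §1 Props 1.2, 1.3 and the criterion Thm 1.4 -/

/-- RH-FREE · **CJM Prop 1.2** (= arXiv:2209.04658 Prop 1.1): for every real `t`, `z ↦ 𝔖_t(z)` belongs
to `L²(ℝ)`. Printed proof (§3.2, TeX l.985–1015): `|Θ_ξ| = 1` on `ℝ`, `𝔖_t` is holomorphic and bounded
on `ℝ` (the poles of `𝔓_t` at `γ` cancel), and `𝔖_t(z) ≪ |z|^{−1} log|z|` from
`ζ′/ζ(½−iz) = Σ_{|Re z−γ|≤1} i/(z−γ) + O(log|z|)` [Titchmarsh Thm 9.6 (A)], the zero count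
[Titchmarsh Thm 9.2] and `(Γ′/Γ)(¼+iz/2) ≪ log|z|`, uniformly for `t` in compacts.
[cite: Suzuki2025WeilHilbertSpace, Prop. 1.2 (TeX l.376–383)] -/
def Suzuki2025_prop12 : Prop :=
  ∀ t : ℝ, MemLp (fun x : ℝ ↦ screwLine t x) 2 volume

/-- RH-FREE · **CJM Prop 1.3** (= arXiv:2209.04658 Prop 1.2): for `φ ∈ C_c^∞(ℝ)`, `P̂_φ ∈ L²(ℝ)` (from the
local uniformity in `t` of the `L²` bound of Prop 1.2 and Minkowski's integral inequality).
[cite: Suzuki2025WeilHilbertSpace, Prop. 1.3 (TeX l.392–405)] -/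
def Suzuki2025_prop13 : Prop :=
  ∀ φ : ℝ → ℂ, IsWeilTest φ → MemLp (fun x : ℝ ↦ screwPhat φ x) 2 volume

/-- RH-EQUIVALENT (line 1): **CJM Thm 1.4** (= arXiv:2209.04658 Cor 1.2) — the RH is true if and only
if `‖P̂_{Dψ}‖²_{L²(ℝ)} = π⟨ψ,ψ⟩_W` (1.9) for all `ψ ∈ C_c^∞(ℝ)`; `⟨ψ,ψ⟩_W = W(ψ ∗ ψ̃)` is COLUMN 2's
`weilQuadratic ψ` (dictionary in the module docstring). Status of the directions in print: `⇒` by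
Thm 4.4 and (4.10) `⟨Dψ,Dψ⟩_{G_g} = ⟨ψ,ψ⟩_W` (= Suzuki JLMS 2023 Prop 3.1); `⇐` is Weil's
criterion re-indexed: (1.9) makes `⟨ψ,ψ⟩_W ≥ 0` on `C_c^∞(ℝ)` (§4.3, TeX l.1303–1333, via
[Yoshida 1992, Lemma 1]). The printed rider "if (1.9) holds for countably many [suitably chosen]
`ψ`'s, then the RH follows" is formally implied and not typed separately.
[cite: Suzuki2025WeilHilbertSpace, Thm. 1.4 (TeX l.420–430)] -/
def Suzuki2025_thm14 : Prop :=
  RiemannHypothesis ↔ ∀ ψ : ℝ → ℂ, IsWeilTest ψ →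
    ((∫ x : ℝ, ‖screwPhat (suzukiD ψ) x‖ ^ 2 : ℝ) : ℂ) = Real.pi * weilQuadratic ψ

/-! ## §3.3 The family `F_γ`, the norm `‖·‖₀`, the space `𝓚₀` -/

/-- RH-FREE object. **`F_γ(z) := √(m_γ/π) · i(1+Θ_ξ(z))/(2(z−γ))`**, `γ ∈ Γ`, of CJM (3.5)
(= JNT 2023 (s213)), indexed by the zero `ρ` with `γ = suzukiZeroParam ρ`. Junk at `z = γ`
(removable singularity) and at the real zeros of `E_ξ`.
[cite: Suzuki2025WeilHilbertSpace, eq. (3.5) (TeX l.1019–1025)] -/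
def screwBasis (ρ z : ℂ) : ℂ :=
  ((Real.sqrt ((riemannZetaZeroOrder ρ : ℝ) / Real.pi) : ℝ) : ℂ) *
    (I * (1 + lagariasTheta z) / (2 * (z - suzukiZeroParam ρ)))

/-- RH-FREE object. The quantity `‖ψ‖₀ := π^{−1/2} ‖P̂_{Dψ}‖_{L²(ℝ)}` of CJM (3.9) on `C_c^∞(ℝ)`,
written as `√((∫‖P̂_{Dψ}(x)‖²dx)/π)` (a real number for every `ψ`; it is the printed one when
`P̂_{Dψ} ∈ L²`, Prop 1.3). [cite: Suzuki2025WeilHilbertSpace, eq. (3.9) (TeX l.1058–1064)] -/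
def screwNormZero (ψ : ℝ → ℂ) : ℝ :=
  Real.sqrt ((∫ x : ℝ, ‖screwPhat (suzukiD ψ) x‖ ^ 2) / Real.pi)

/-- RH-FREE · **CJM Lemma 3.2**: (3.9) defines a norm on `C_c^∞(ℝ)` — subadditive, absolutely
homogeneous, and definite (`‖ψ‖₀ = 0 ⇒ ψ = 0`; printed proof: `P̂_{Dψ} ≡ 0` forces `ψ̂(γ) = 0` for all
`γ ∈ Γ` by (3.5)/(3.8), hence `ψ = 0` by Suzuki JLMS 2023 Lemma 2.1 = `Suzuki2023_lemma21`).
[cite: Suzuki2025WeilHilbertSpace, Lemma 3.2 (TeX l.1073–1093)] -/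
def Suzuki2025_lemma32 : Prop :=
  (∀ ψ₁ ψ₂ : ℝ → ℂ, IsWeilTest ψ₁ → IsWeilTest ψ₂ →
      screwNormZero (ψ₁ + ψ₂) ≤ screwNormZero ψ₁ + screwNormZero ψ₂) ∧
    (∀ (k : ℂ) (ψ : ℝ → ℂ), IsWeilTest ψ → screwNormZero (k • ψ) = ‖k‖ * screwNormZero ψ) ∧
    ∀ ψ : ℝ → ℂ, IsWeilTest ψ → screwNormZero ψ = 0 → ψ = 0

/-- RH-FREE object. **`𝓚₀`** := the `L²(ℝ)`-closure of the image `P̂_D(C_c^∞(ℝ))` (CJM §3.3, TeX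
l.1097–1099), as a subset of `L²(ℝ)`: the closure of the classes represented by some `P̂_{Dψ}`,
`ψ ∈ C_c^∞(ℝ)`. (Under RH `𝓚₀ = 𝒦(Θ_ξ)`, Thm 5.6 — not here. The completion `𝓗₀` of
`(C_c^∞(ℝ), ‖·‖₀)` is not materialised.) [cite: Suzuki2025WeilHilbertSpace, §3.3 (TeX l.1095–1107)] -/
def screwK0 : Set (Lp ℂ 2 (volume : Measure ℝ)) :=
  closure {F | ∃ ψ : ℝ → ℂ, IsWeilTest ψ ∧ (F : ℝ → ℂ) =ᵐ[volume] fun x ↦ screwPhat (suzukiD ψ) x}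

/-! ## §§2.3–2.4, 4.1: `H²`, `𝒦(Θ)` as boundary-value predicates; Prop 4.1 -/

/-- RH-FREE object. The Hardy space **`H² = H²(ℂ₊) = 𝖥L²(0,∞)`**, identified with a closed subspace
of `L²(ℝ)` via boundary values (CJM §2.3, TeX l.615–619), as a SET of `L²(ℝ)`-classes: those whose
Mathlib Fourier transform vanishes a.e. on `(−∞,0)` (convention bookkeeping in the module
docstring: Suzuki's `𝖥` is Mathlib's `𝓕⁻` up to a dilation preserving `L²(0,∞)`). Membership
predicate only. [cite: Suzuki2025WeilHilbertSpace, §2.3 (TeX l.615–619)] -/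
def hardyL2 : Set (Lp ℂ 2 (volume : Measure ℝ)) :=
  {F | (𝓕 F : Lp ℂ 2 (volume : Measure ℝ)) ∈ halfLineL2 0}

/-- RH-FREE object. The model space **`𝒦(Θ) = H² ⊖ ΘH²`** (CJM §2.4, TeX l.689–700) for a symbol
`Θ : ℂ → ℂ` restricted to the real line, as a SET of `L²(ℝ)`-classes: `F ∈ H²` orthogonal in `L²(ℝ)`
to `Θ·G` for every `G ∈ H²` (`∫ conj(Θ(x)G(x)) F(x) dx = 0`; for `|Θ| ≤ 1` a.e. on `ℝ` — e.g.
`Θ = Θ_ξ`, `norm_lagariasTheta_ofReal_le_one` — the integrand is integrable for `F, G ∈ L²`, no junk).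
For an inner `Θ` (under RH for `Θ = Θ_ξ`) this is the printed closed subspace; in general it is just
this set. Membership predicate only. [cite: Suzuki2025WeilHilbertSpace, §2.4 (TeX l.689–700)] -/
def modelSpaceL2 (Θ : ℂ → ℂ) : Set (Lp ℂ 2 (volume : Measure ℝ)) :=
  {F | F ∈ hardyL2 ∧ ∀ G ∈ hardyL2, ∫ x : ℝ, conj (Θ x * G x) * F x = 0}

/-- RH-CONSEQUENCE (printed "Assume that the RH is true"): **CJM Prop 4.1** (= arXiv:2209.04658
Prop 3.1 = Suzuki, JNT 252 (2023), Prop 3.2): under RH the family `(F_γ)_{γ∈Γ}` of (3.5) is an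
orthonormal basis of the Hilbert space `𝒦(Θ_ξ) ⊂ L²(ℝ)` (typed: the `F_γ|_ℝ` are in `L²`, orthonormal,
and their closed span is `modelSpaceL2 lagariasTheta`); furthermore (4.1) `Θ′(γ)/2 = −i/m_γ` and
(4.2) `F_γ(γ) = 1/√(m_γ π)`, `F_γ(γ′) = 0` (`γ′ ∈ Γ∖{γ}`) — typed as the limits
`lim_{z→γ}(1+Θ(z))/(2(z−γ)) = −i/m_γ` (the printed computation, JNT 2023 after (s214)) and the
corresponding limits of `F_γ`, which are the printed values at the removable points. Printed proof:
[de Branges 1968, Thm 22] + [Makarov–Poltoratski 2005, Thm 2.1], via JNT 2023 Prop 3.2.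
[cite: Suzuki2025WeilHilbertSpace, Prop. 4.1 (TeX l.1120–1141)] -/
def Suzuki2025_prop41 : Prop :=
  RiemannHypothesis →
    (∃ hF : ∀ ρ : ZetaZeros.riemannZetaNontrivialZeros, MemLp (fun x : ℝ ↦ screwBasis ρ x) 2 volume,
      Orthonormal ℂ (fun ρ : ZetaZeros.riemannZetaNontrivialZeros ↦
          ((hF ρ).toLp _ : Lp ℂ 2 (volume : Measure ℝ))) ∧
        modelSpaceL2 lagariasTheta =
          ↑(Submodule.span ℂ (Set.range fun ρ : ZetaZeros.riemannZetaNontrivialZeros ↦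
              ((hF ρ).toLp _ : Lp ℂ 2 (volume : Measure ℝ)))).topologicalClosure) ∧
    (∀ ρ ∈ ZetaZeros.riemannZetaNontrivialZeros,
      Tendsto (fun z : ℂ ↦ (1 + lagariasTheta z) / (2 * (z - suzukiZeroParam ρ)))
        (𝓝[≠] suzukiZeroParam ρ) (𝓝 (-I / (riemannZetaZeroOrder ρ : ℂ)))) ∧
    ∀ ρ ∈ ZetaZeros.riemannZetaNontrivialZeros,
      Tendsto (screwBasis ρ) (𝓝[≠] suzukiZeroParam ρ)
          (𝓝 (((1 / Real.sqrt ((riemannZetaZeroOrder ρ : ℝ) * Real.pi) : ℝ) : ℂ))) ∧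
        ∀ ρ' ∈ ZetaZeros.riemannZetaNontrivialZeros, ρ' ≠ ρ →
          Tendsto (screwBasis ρ) (𝓝[≠] suzukiZeroParam ρ') (𝓝 0)

/-! ## §4.2 The screw line theorem and Cor 4.3 -/

/-- RH-CONSEQUENCE (printed "Assume the RH is true"): **CJM Thm 4.2** (= arXiv:2209.04658 Thm 1.1). Let
`g = g_ξ` (`= −zetaScrew`). Under RH, `t ↦ π^{−1/2}𝔖_t` from `ℝ` to `L²(ℝ)` is a screw line of `g`;
"that is, `(1/π)⟨𝔖_t, 𝔖_u⟩_{L²(ℝ)} = G_g(t,u)` (4.4) holds for `t, u ∈ ℝ`" (`⟨F,G⟩ = ∫ F conj G`;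
`G_g = zetaScrewKernel`). Typed as (4.4) together with the screw-line property of §2.1 for the
`L²`-classes (the latter presupposes Prop 1.2, quantified as its hypothesis `hS`). Printed proof:
the expansion (3.6) with `ℓ²` coefficients, Prop 4.1, (4.9) `G_g(t,u) = Σ m_γ (e^{iγt}−1)(e^{−iγu}−1)/γ²`
[Suzuki JLMS 2023 (1.9)] and `𝔖_0 ≡ 0`. [cite: Suzuki2025WeilHilbertSpace, Thm. 4.2 (TeX l.1182–1194)] -/
def Suzuki2025_thm42 : Prop :=
  RiemannHypothesis →
    (∀ t u : ℝ, (1 / Real.pi : ℂ) * ∫ x : ℝ, screwLine t x * conj (screwLine u x) =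
        (zetaScrewKernel t u : ℂ)) ∧
      ∀ hS : ∀ t : ℝ, MemLp (fun x : ℝ ↦ screwLine t x) 2 volume,
        IsScrewLineFor
          (fun t ↦ ((Real.sqrt Real.pi)⁻¹ : ℂ) • ((hS t).toLp _ : Lp ℂ 2 (volume : Measure ℝ)))
          (fun t u ↦ (zetaScrewKernel t u : ℂ))

/-- RH-EQUIVALENT (line 1): **CJM Cor 4.3** (= arXiv:2209.04658 Cor 1.1) — the RH is true if and only if
`(1/2π)‖𝔖_t‖²_{L²(ℝ)} = −g(t)` (4.6) holds for all `t ≥ t₀`, for some `t₀ ≥ 0` (`−g = −g_ξ = zetaScrew`).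
Directions in print: `⇒` from (4.4) at `u = t` (`G_g(t,t) = −2g(t)`); `⇐`: (4.6) makes `−g ≥ 0` on
`[t₀,∞)`, which implies RH by Suzuki JLMS 2023 Thms 1.7 and 11.1.
[cite: Suzuki2025WeilHilbertSpace, Cor. 4.3 (TeX l.1250–1258)] -/
def Suzuki2025_cor43 : Prop :=
  RiemannHypothesis ↔ ∃ t₀ : ℝ, 0 ≤ t₀ ∧ ∀ t : ℝ, t₀ ≤ t →
    1 / (2 * Real.pi) * ∫ x : ℝ, ‖screwLine t x‖ ^ 2 = zetaScrew t

/-! ## §4.3 Thm 4.4 (Thm 4.5 = Thm 1.4 ÷ π is PROVED from `Suzuki2025_thm14` in `SuzukiScrewLineProofs.lean`) -/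

/-- RH-EQUIVALENT (line 1): **CJM Thm 4.4** (= arXiv:2209.04658 Thm 1.2). Let `g = g_ξ`. The RH is true
if and only if `‖P̂_φ‖²_{L²(ℝ)} = π⟨φ,φ⟩_{G_g}` (4.7) for all `φ ∈ C_c^∞(ℝ)` with `φ̂(0) = ∫φ = 0`; and if
the RH is true, (4.7) holds for all `φ ∈ C_c^∞(ℝ)` (`⟨φ,φ⟩_{G_g}` of (2.2) = `zetaScrewForm univ φ φ`).
Directions in print: `⇒` by (3.7), Prop 4.1 and (4.9); `⇐` by contradiction from a non-real `γ₀ ∈ Γ` with [Yoshida 1992, Lemma 1] and (4.10) — i.e.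
Weil negativity at an off-line zero. [cite: Suzuki2025WeilHilbertSpace, Thm. 4.4 (TeX l.1274–1284)] -/
def Suzuki2025_thm44 : Prop :=
  (RiemannHypothesis ↔ ∀ φ : ℝ → ℂ, IsWeilTest φ → ∫ t : ℝ, φ t = 0 →
      ((∫ x : ℝ, ‖screwPhat φ x‖ ^ 2 : ℝ) : ℂ) = Real.pi * zetaScrewForm univ φ φ) ∧
    (RiemannHypothesis → ∀ φ : ℝ → ℂ, IsWeilTest φ →
      ((∫ x : ℝ, ‖screwPhat φ x‖ ^ 2 : ℝ) : ℂ) = Real.pi * zetaScrewForm univ φ φ)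

/-! ## §7 Special values (Thm 7.1) -/

/-- RH-FREE · **CJM Thm 7.1** (= arXiv:2209.04658 Thm 4.1), "independently of the truth of the RH":
(7.1) `𝔓_t(0) = −g_ξ(t)` (`= zetaScrew t`), the value of the meromorphic function `𝔓_t` at its regular
point `0 ∉ Γ`, obtained in print "by taking the limit `z → 0` in (1.6)" — typed as that limit; and
(7.2) `lim_{y→+∞} [y𝔓_t(−iy) − ½(Γ′/Γ)(¼+y/2) + ½log π] = −g_ξ′(t)` for `t > 0`, `t ≠ log n`
(`n ∈ ℕ`) (`−g_ξ′ = (zetaScrew)′`; the printed "`𝔅_t`" is `𝔓_t`), the limit taken along `y → +∞`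
off the cancelling poles `y = 2n+½` of the individual terms of (1.6) (module docstring).
Printed proof: `Φ`- and `Γ′/Γ`-limits, `ψ₁(¼) = Φ(1,2,¼)`, `(Γ′/Γ)(¼) = −γ₀ − 3log 2 − π/2`,
`ζ′/ζ(½) = ½(γ₀ + 3log 2 + log π + π/2)` from `ξ(s) = ξ(1−s)` (TeX l.2131–2226).
[cite: Suzuki2025WeilHilbertSpace, Thm. 7.1 (TeX l.2114–2129)] -/
def Suzuki2025_thm71 : Prop :=
  (∀ t : ℝ, Tendsto (screwP t) (𝓝[≠] 0) (𝓝 (zetaScrew t : ℂ))) ∧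
    ∀ t : ℝ, 0 < t → (∀ n : ℕ, t ≠ Real.log n) →
      Tendsto
        (fun y : ℝ ↦ (y : ℂ) * screwP t (-(I * y)) - 1 / 2 * Complex.digamma (1 / 4 + y / 2) +
          1 / 2 * Real.log Real.pi)
        (atTop ⊓ 𝓟 {y : ℝ | ∀ n : ℕ, y ≠ 2 * n + 1 / 2}) (𝓝 ((deriv zetaScrew t : ℝ) : ℂ))

end Literature.NumberTheory.LFunctions

end
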